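/-
Copyright (c) 2026 the pub-hodgecm-mathlib formalisation cell (harness21).  Prover seat hodgecm-mathlib-K2E1-p15 (g3), Track B ∕ K2-LIT, h413 = `stmt-HodgeConjecture-24833`,
R90-TF section S8 «ContSpec-n½» (planner R90-CS-plan (g0), hand «p07-early» = S8B#9 made GENERIC, dealt 2026-09-04T15:44:36Z): local constituents travel along an
intertwining equivalence of discrete automorphic representations — the ENGINE of `Theorems/R90S8MemXiFamilyOfEquiv.lean`.
-/
import Literature.NumberTheory.Rogawski1990.GlobalAPacketMembership        -- ★ D6: `LocalConstituentsIn`, `LocalConstituentsIn.of_constituents`; brings ★ `DiscreteAutomorphicRep.finRep`, ★ `inclPlace`, ★ `localPiEquiv`, ★ `Representation.smoothPart`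
import Literature.NumberTheory.Automorphic.IrreducibleClassesConstituents   -- ★ `IrrClass.IsConstituentOf.of_injective`
import HarnessLib

/-!
# S8B#9 (engine) — `R90S8LocalConstituentsInOfEquiv`: the finite local constituents of a discrete automorphic representation are invariant under an intertwining
# equivalence; hence ★ `LocalConstituentsIn P Pv` travels along `P ≃ᵤ P′`

Track B ∕ K2-LIT, crux h413 = `stmt-HodgeConjecture-24833`, route of record `HCCMUnconditional`; cell `hodgecm-mathlib`, R90-TF programme, section S8 «ContSpec-n½»
(§13.9 residual spectrum), support S8B#9 of the S8 socket plan (file B `R90_S8_ResidualSpectrumU3B` keeps `isPiN_of_equiv` as the B-level statement and cites this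
engine).  THEOREMS ONLY (no `def`, no `instance`, no `notation`, no named-fact hypothesis, no `sorry`; default heartbeats); lane `--supports stmt-HodgeConjecture-24833
--as helper` (count-neutral).

THE MATHEMATICS ([Dixmier1977, §13.1.3]; [BushnellHenniart2006, §2]; [Rogawski1990, §13.3 p. 201]).  Let `P, P′ ≤ L²(U(J)(F)\U(J)(𝔸_F))` be discrete automorphic
representations of an adelic unitary group (★ `DiscreteAutomorphicRep (adelicGroupData F E c N J) μ`; the measures `μ, μ′` may differ) and `e : P ≃ P′` an intertwining
continuous linear equivalence of the restricted representations (Mathlib `ContRepresentation.Equiv`; isometry is NOT needed).  Restricting along `U(J)(𝔸_{F,f}) →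
U(J)(𝔸_F)` (★ `finAdelicToAdelic`), `e` intertwines `P.finRep` and `P′.finRep` (★ `DiscreteAutomorphicRep.finRep := P.toContRep ∘ finAdelicToAdelic`), so it carries
the stabiliser of a vector of `P` onto the stabiliser of its image: SMOOTH vectors go to smooth vectors (★ `Representation.isSmoothVector_of_le`), and `e` restricts to an
INJECTIVE `U(J)(𝔸_{F,f})`-map `P.finRep^∞ → P′.finRep^∞` of the smooth parts (★ `Representation.smoothPart`), equivariant for every group mapping to `U(J)(𝔸_{F,f})` — in
particular for `U(J)(F_v) ↪ U(J)(𝔸_{F,f})` (★ `inclPlace v`).  An irreducible subquotient of `P.finRep^∞|_Γ` is then an irreducible subquotient of `P′.finRep^∞|_Γ` (★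
`IrrClass.IsConstituentOf.of_injective`): the CONSTITUENTS AGREE (§1, both directions by symmetry).  Consequently Rogawski's «`π_v ∈ Π_v` for all finite `v`» envelope
★ `LocalConstituentsIn P Pv` (D6, `GlobalAPacketMembership`) passes from `P` to any `P′ ≃ᵤ P` (§2, via ★ `LocalConstituentsIn.of_constituents` at `e⁻¹`).
PROVENANCE (C1): the construction of §1 is the one performed INSIDE the proof of ★ `F0P3RamClsOfRecord.admUnitConstituents_subset_of_areUnitarilyEquivalent`
(`Theorems/F0P3RamClsOfRecordTransport.lean`), whose conclusion carries the extra conjuncts `IsAdmissible ∧ IsUnitarizable` and is therefore not citable for bare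
constituents; it is exported here as a named lemma, generic in the datum `(F, E, c, N, J)`, the two measures and the test group `Γ →* U(J)(𝔸_{F,f})`.
* §1 **`isConstituentOf_finRep_smoothPart_comp_of_equiv`** — the engine (any `adelicGroupData F E c N J`, any `φ : Γ →* finAdelic F E c N J`).
* §2 **`localConstituentsIn_of_areUnitarilyEquivalent`** — THE HEAD: `P ≃ᵤ P′ ⇒ (LocalConstituentsIn P Pv ⇒ LocalConstituentsIn P′ Pv)` (CM datum `cmDatum L 3 H`, D6 currency).
HONEST LABEL: HC_CM is proved only modulo the 7 printed citations (2 remaining named inputs: hLiu418 = `stmt-HodgeConjecture-24832`, h413 = `stmt-HodgeConjecture-24833`) until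
rung 0 closes; this file asserts no named fact and closes no socket; count-neutral.

## References
* [Dixmier1977] J. Dixmier, *C\*-algebras* (North-Holland, 1977), §13.1.3 (equivalent representations).
* [BushnellHenniart2006] C. J. Bushnell, G. Henniart, *The Local Langlands Conjecture for GL(2)* (Springer, 2006), §2 (smooth representations, composition factors).
* [Rogawski1990] J. Rogawski, *Automorphic Representations of Unitary Groups in Three Variables*, Ann. of Math. Stud. 123 (1990), §13.3 p. 201; §14.6 p. 244.
-/

set_option autoImplicit false
set_option linter.dupNamespace false  -- the mandated namespace `…HodgeConjecture.HodgeConjecture.R90.S8` (LEAD #1 L1) repeats the summit's segment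

noncomputable section

open MeasureTheory NumberField IsDedekindDomain
open scoped Matrix ComplexOrder
open Literature.NumberTheory.Automorphic Literature.NumberTheory.Automorphic.UnitaryGroup
open Literature.NumberTheory.Automorphic.UnitaryGroup.CotangentForms
open Literature.NumberTheory.Rogawski1990
open ContRepresentation (AreUnitarilyEquivalent)

namespace Summit.HodgeConjecture.HodgeConjecture.R90.S8

/-! ## §1 The engine: constituents of the smooth finite part travel along an intertwining equivalence -/

section Engine

variable {F E : Type} [Field F] [NumberField F] [Field E] [NumberField E] [Algebra F E]
  {c : E ≃ₐ[F] E} {N : ℕ} {J : Matrix (Fin N) (Fin N) E}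
  {μ μ' : Measure (adelicGroupData F E c N J).automorphicQuotient}
  [SMulInvariantMeasure (adelicGroupData F E c N J).Adelic (adelicGroupData F E c N J).automorphicQuotient μ]
  [SMulInvariantMeasure (adelicGroupData F E c N J).Adelic (adelicGroupData F E c N J).automorphicQuotient μ']

/-- **Constituents of the smooth finite part travel along an intertwining equivalence.**  For discrete automorphic representations `P, P′` of
`U(J)(𝔸_F)` and an intertwining continuous linear equivalence `e : P ≃ P′` (no isometry needed), every constituent of `P.finRep^∞` restricted along a
group homomorphism `φ : Γ → U(J)(𝔸_{F,f})` is a constituent of `P′.finRep^∞` restricted along `φ`: `e` maps `P.finRep`-smooth vectors to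
`P′.finRep`-smooth vectors (stabilisers correspond under `e`) and restricts to an injective `Γ`-intertwiner of the smooth parts (★
`IrrClass.IsConstituentOf.of_injective`).  The construction is the one inside the proof of ★
`F0P3RamClsOfRecord.admUnitConstituents_subset_of_areUnitarilyEquivalent`, exported. [cite: Dixmier1977, §13.1.3] [cite: BushnellHenniart2006, §2] -/
theorem isConstituentOf_finRep_smoothPart_comp_of_equiv
    {P : DiscreteAutomorphicRep (adelicGroupData F E c N J) μ} {P' : DiscreteAutomorphicRep (adelicGroupData F E c N J) μ'}
    (e : P.space.toContRep.Equiv P'.space.toContRep)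
    {Γ : Type*} [Group Γ] [TopologicalSpace Γ] (φ : Γ →* finAdelic F E c N J) {cl : IrrClass Γ}
    (h : cl.IsConstituentOf (P.finRep.smoothPart.toRepresentation.comp φ)) :
    cl.IsConstituentOf (P'.finRep.smoothPart.toRepresentation.comp φ) := by
  -- the intertwining identity on vectors, restricted to the finite-adelic group
  have he : ∀ (b : finAdelic F E c N J) (x : ↥P.space.toSubmodule),
      e.toContinuousLinearEquiv (P.finRep b x) = P'.finRep b (e.toContinuousLinearEquiv x) := fun b x =>
    DFunLike.congr_fun (e.isIntertwining (finAdelicToAdelic F E c N J b)) x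
  -- `e` maps smooth vectors of `P.finRep` to smooth vectors of `P'.finRep`
  have hsm : ∀ x : ↥P.finRep.smoothPart.toSubmodule, P'.finRep.IsSmoothVector (e.toContinuousLinearEquiv (x : ↥P.space.toSubmodule)) := by
    intro x
    refine P'.finRep.isSmoothVector_of_le x.2 fun g hg => ?_
    rw [Representation.mem_stabilizerSubgroup, ← he, (P.finRep.mem_stabilizerSubgroup _ g).1 hg]
  -- the restriction of `e` to the smooth parts, as a linear map
  let f₀ : ↥P.finRep.smoothPart.toSubmodule →ₗ[ℂ] ↥P'.finRep.smoothPart.toSubmodule :=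
    { toFun := fun x => ⟨e.toContinuousLinearEquiv (x : ↥P.space.toSubmodule), hsm x⟩
      map_add' := fun x y => Subtype.ext (by simp only [Submodule.coe_add, map_add])
      map_smul' := fun a x => Subtype.ext (by simp only [Submodule.coe_smul, map_smul, RingHom.id_apply]) }
  -- … which intertwines the `Γ`-actions through `φ`
  let f : Representation.IntertwiningMap (P.finRep.smoothPart.toRepresentation.comp φ) (P'.finRep.smoothPart.toRepresentation.comp φ) :=
    LinearMap.intertwiningMap_of_isIntertwiningMap
      (ρ := P.finRep.smoothPart.toRepresentation.comp φ) (σ := P'.finRep.smoothPart.toRepresentation.comp φ) f₀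
      fun g x => Subtype.ext (he _ _)
  -- and is injective because `e` is
  have hf : Function.Injective f := by
    intro a b hab
    have h' : f₀ a = f₀ b := hab
    have h'' : e.toContinuousLinearEquiv (a : ↥P.space.toSubmodule) = e.toContinuousLinearEquiv (b : ↥P.space.toSubmodule) :=
      congrArg Subtype.val h'
    exact Subtype.ext (e.toContinuousLinearEquiv.injective h'')
  exact h.of_injective f hf

end Engine

/-! ## §2 The head: `LocalConstituentsIn` travels along a unitary equivalence (D6 currency, `U(H)` for `H ∈ M₃(L)`) -/

section Head

variable {L : Type} [Field L] [NumberField L] [IsCMField L] {H : Matrix (Fin 3) (Fin 3) L}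
  {μ μ' : Measure (adelicGroupData (↥(maximalRealSubfield L)) L (IsCMField.complexConj L) 3 H).automorphicQuotient}
  [(adelicGroupData (↥(maximalRealSubfield L)) L (IsCMField.complexConj L) 3 H).IsAutomorphicMeasure μ]
  [(adelicGroupData (↥(maximalRealSubfield L)) L (IsCMField.complexConj L) 3 H).IsAutomorphicMeasure μ']

/-- **S8B#9 (head) — `LocalConstituentsIn` is invariant under unitary equivalence.**  If `P ≃ᵤ P′` (★ `AreUnitarilyEquivalent` of the restricted
representations) and every finite local constituent of `P` lies in the family of local packets `Pv` (★ D6 `LocalConstituentsIn P Pv`), then so does every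
finite local constituent of `P′`: by §1 at `e⁻¹`, the constituents of `P′.finRep^∞|_{U(H)(L⁺_v)}` are constituents of `P.finRep^∞|_{U(H)(L⁺_v)}` (★
`LocalConstituentsIn.of_constituents`). [cite: Rogawski1990, §13.3 p. 201] [cite: Dixmier1977, §13.1.3] -/
theorem localConstituentsIn_of_areUnitarilyEquivalent
    {P : DiscreteAutomorphicRep (adelicGroupData (↥(maximalRealSubfield L)) L (IsCMField.complexConj L) 3 H) μ}
    {P' : DiscreteAutomorphicRep (adelicGroupData (↥(maximalRealSubfield L)) L (IsCMField.complexConj L) 3 H) μ'}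
    (h : AreUnitarilyEquivalent P.space.toContRep P'.space.toContRep)
    {Pv : ∀ v : HeightOneSpectrum (𝓞 ↥(maximalRealSubfield L)), CMLocalAPacket L H v} (hP : LocalConstituentsIn P Pv) :
    LocalConstituentsIn P' Pv := by
  obtain ⟨e, -⟩ := h
  exact hP.of_constituents fun v cl hc =>
    isConstituentOf_finRep_smoothPart_comp_of_equiv e.symm (inclPlace (↥(maximalRealSubfield L)) L (IsCMField.complexConj L) 3 H v) hc

end Head

end Summit.HodgeConjecture.HodgeConjecture.R90.S8

end
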